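import Summits.Ventures.CertifiedArithmetic.LowPrec.SRSpacing
import Summits.Ventures.CertifiedArithmetic.LowPrec.SRTreeDesignData
import HarnessLib

/-!
# Rung R3, accumulation order as a design variable: the every-format SR statements as venture Props

HONEST FRAMING: certified error envelopes and provably optimal rounding/accumulation schemes for
low-precision formats under stated cost models; every table by two implementations; no hardware or
vendor claims.

`SRRungR3.lean` / `SRRungR3Trees.lean` state the SR statements whose constants were obtained by
ENUMERATING a small format (E2M1 … E5M2).  This file states, over the substrate value set
`MiniFloat.valueSet φ` of an ARBITRARY format `φ` (bfloat16, binary16, binary32 included — no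
enumeration anywhere), the generation-3 statements and inhabits each Prop by a landed theorem
(no new mathematics here):

* `R3_SRSpacingLaw φ` — the candidate gap of every point of the hull is `≤ max(quantum, 2u·|c|)`
  (`SRSpacing.lean`; tight: equality at every power of two and throughout the subnormal binade);
* `R3_SRGlobalEnvelope φ`, `R3_SRWindowEnvelope φ` — the `√n` variance envelopes of recursive
  summation with the format-generic constants `G = 2^(emaxCode−1)·quantum` (whole hull) and
  `G = 2^J·quantum` (partial sums certified inside the window `|·| ≤ 2^(m+1+J)·quantum`);
* `R3_SRSecondMoment φ` — for EVERY summation tree, absent saturation,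
  `Var ŝ_T ≤ (1+u²)^(h−1) · (u² · Σ_nodes s_v² + m·quantum²/4)`: the accumulation order enters the
  variance bound through ONE statistic, the sum over the internal nodes of the squared exact partial
  sums (`SR.sqNodes`), plus the subnormal floor (`SRSecondMoment.lean`);
* `R3_SROptimalShape` — for equal summands that statistic is `a² · SR.sizeSq T`, and pairwise
  (halving) summation MINIMISES `sizeSq` over all binary trees with the same number of leaves, the
  minimum being `SR.optSq n ≤ 2n² − n − 1` against `(n(n+1)(2n+1) − 6)/6 ~ n³/3` for recursive
  summation (`SRTreeDesign.lean`; Huffman merging is NOT optimal for unequal summands,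
  `SR.huffman_not_optimal_sqSum`);
* `R3_SRPairwiseDesign φ` — the resulting design guarantee in every format: for summands in
  `[amin, a]`, `0 < amin`, summed pairwise without saturation,
  `Var ŝ ≤ (1+u²)^(⌈log₂ n⌉−1) · (3u²(a/amin)·S² + (n−1)·quantum²/4)`, i.e. a relative standard
  deviation `≤ (1+u²)^((⌈log₂ n⌉−1)/2) · u · √(3a/amin)` INDEPENDENT of `n` above the subnormal
  floor, where recursive summation gives `≈ u·√(n/3)` (`SRTreeDesignData.lean`).

Certificates (two independent implementations, byte-identical; `certs/sr/gen3/`): `optSq` and its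
convexity for `n ≤ 4096`; all 329 weighted multisets of size `≤ 7` over `{1,…,4}` (Huffman strictly
suboptimal in 189, pairwise-on-sorted in 285); 24 exact tree variances in E3M2/E2M3/E4M3/E5M2
against the second-moment bound (ratio `≤ 0.42`); the spacing law pair-by-pair on eight formats
including binary32 (`2 139 095 039` consecutive pairs, by binade); the design table for bfloat16 /
binary16 / binary32 / E5M2 / E4M3, `n ≤ 65536`.
-/

namespace Summit.Ventures.CertifiedArithmetic

open Literature.ComputerArithmetic.FloatingPoint
open Literature.ComputerArithmetic.FloatingPoint.MiniFloat
open Literature.ComputerArithmetic.FloatingPoint.Format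
open Summit.Ventures.CertifiedArithmetic.LowPrec
open Literature.ComputerArithmetic.ConnollyHighamMary2021 (roundUp roundDown)
open Finset

/-! ### The spacing law and the format-generic `√n` envelopes -/

/-- R3 (spacing law, every format): for every `c` in the hull `[−maxRat, maxRat]` of the value set,
the two rounding candidates satisfy `⌈c⌉ − ⌊c⌋ ≤ max(quantum, 2u·|c|)`, `u = 2^−(manBits+1)`.
PROVED (sr seat): `LowPrec.SR.valueSet_gap_le_max` (SRSpacing.lean; the underlying grid statement is
`MiniFloat.roundUp_sub_roundDown_le_max`). -/
def R3_SRSpacingLaw (φ : Format) : Prop :=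
  ∀ c : ℚ, SR.InHull (valueSet φ) c →
    roundUp (valueSet φ) c - roundDown (valueSet φ) c
      ≤ max φ.quantum (2 * φ.unitRoundoff * |c|)

/-- `R3_SRSpacingLaw`: PROVED for every format. -/
theorem R3_SRSpacingLaw_holds (φ : Format) : R3_SRSpacingLaw φ :=
  fun _ hc => SR.valueSet_gap_le_max φ hc

/-- R3 (global `√n` envelope, every format, no hypothesis): the exact variance functional of
recursive SR summation satisfies `accVar ≤ n·G²/4` with `G = 2^(emaxCode−1)·quantum` the largest
spacing of the format (E4M3: `G = 32`, the constant previously obtained by enumeration; binary16: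
`32`; bfloat16: `2^126`).  PROVED (sr seat): `LowPrec.SR.valueSet_accVar_le_top` (SRSpacing.lean).
-/
def R3_SRGlobalEnvelope (φ : Format) : Prop :=
  ∀ (x : ℕ → ℚ) (n : ℕ) (s : ℚ),
    SR.accVar (valueSet φ) x n s ≤ n * (2 ^ (φ.emaxCode - 1) * φ.quantum) ^ 2 / 4

/-- `R3_SRGlobalEnvelope`: PROVED for every format. -/
theorem R3_SRGlobalEnvelope_holds (φ : Format) : R3_SRGlobalEnvelope φ :=
  fun x n s => SR.valueSet_accVar_le_top φ x n s

/-- R3 (window `√n` envelope, every format): if `2^(m+1+J) ≤ maxScaled` and along every branch every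
clamped pre-rounding value lies in the window `[−2^(m+1+J)·quantum, 2^(m+1+J)·quantum]`, then
`accVar ≤ n·(2^J·quantum)²/4` — the format-exact form of the `u · max|partial sum|` constant.
PROVED (sr seat): `LowPrec.SR.valueSet_accVar_le_window` (SRSpacing.lean). -/
def R3_SRWindowEnvelope (φ : Format) : Prop :=
  ∀ J : ℕ, 2 ^ (φ.manBits + 1 + J) ≤ φ.maxScaled → ∀ (x : ℕ → ℚ) (n : ℕ) (s : ℚ),
    SR.InWindow (valueSet φ) (-(2 ^ (φ.manBits + 1 + J) * φ.quantum))
        (2 ^ (φ.manBits + 1 + J) * φ.quantum) x n s →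
      SR.accVar (valueSet φ) x n s ≤ n * (2 ^ J * φ.quantum) ^ 2 / 4

/-- `R3_SRWindowEnvelope`: PROVED for every format. -/
theorem R3_SRWindowEnvelope_holds (φ : Format) : R3_SRWindowEnvelope φ :=
  fun _ hmax x n s hw => SR.valueSet_accVar_le_window φ hmax x n s hw

/-! ### The node second moment: how the order enters the variance -/

/-- R3 (second-moment variance bound, every format, every tree): absent saturation on every branch,
`Var ŝ_T = SR.treeVar ≤ (1 + u²)^(h−1) · (u² · SR.sqNodes T + m · quantum²/4)`, where `h` is the
height, `m = n − 1` the number of roundings and `SR.sqNodes T = Σ_{internal nodes v} s_v²` the sum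
of the squared EXACT partial sums.  (Mechanism: at a node, `E(ŝ_l + ŝ_r)² = treeVar l + treeVar r +
(s_l + s_r)²` exactly, and the one-step variance is `≤ (u·|c|)² + quantum²/4` by the spacing law.)
PROVED (sr seat): `LowPrec.SR.valueSet_treeVar_le_secondMoment` (SRSecondMoment.lean; the abstract
form over any finite number system with a spacing law is `SR.treeVar_le_secondMoment`). -/
def R3_SRSecondMoment (φ : Format) : Prop :=
  ∀ T : SR.STree ℚ, SR.NoSatT (valueSet φ) T →
    SR.treeVar (valueSet φ) T ≤ (1 + φ.unitRoundoff ^ 2) ^ (T.height - 1)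
      * (φ.unitRoundoff ^ 2 * SR.sqNodes T + T.nodes * φ.quantum ^ 2 / 4)

/-- `R3_SRSecondMoment`: PROVED for every format. -/
theorem R3_SRSecondMoment_holds (φ : Format) : R3_SRSecondMoment φ :=
  fun T h => SR.valueSet_treeVar_le_secondMoment φ T h

/-! ### Design: the optimal shape and the pairwise guarantee -/

/-- R3 (design, shape optimality — format-free combinatorics): for every binary tree `T`, the
pairwise (halving) tree on the same number of leaves has `sizeSq` (the sum over internal nodes of
the squared leaf counts — the order statistic `sqNodes` for equal summands, up to the factor `a²`)
at most that of `T`, and its value is the closed recursion `SR.optSq` (`optSq n = n² + optSq ⌊n/2⌋ +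
optSq ⌈n/2⌉`, `optSq (2^k) = 2·4^k − 2^(k+1)`, `optSq n ≤ 2n² − n − 1`; recursive summation has
`(n(n+1)(2n+1) − 6)/6`, `SR.sizeSq_comb`).  PROVED (sr seat): `LowPrec.SR.sizeSq_pairwise_le`,
`SR.sizeSq_pairwise`, `SR.optSq_le_sizeSq` (SRTreeDesign.lean; convexity of `optSq` and an exchange
argument).  Stated over `ℚ`-labelled trees; the landed theorems are polymorphic in the leaf type. -/
def R3_SROptimalShape : Prop :=
  ∀ (x : ℕ → ℚ) (o : ℕ) (T : SR.STree ℚ),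
    SR.sizeSq (SR.pairwise x o T.leaves) ≤ SR.sizeSq T
      ∧ SR.sizeSq (SR.pairwise x o T.leaves) = SR.optSq T.leaves

/-- `R3_SROptimalShape`: PROVED. -/
theorem R3_SROptimalShape_holds : R3_SROptimalShape :=
  fun x o T => ⟨SR.sizeSq_pairwise_le x o T, SR.sizeSq_pairwise x _ _ (SR.leaves_pos T)⟩

/-- R3 (design guarantee, every format): summing `n ≥ 1` summands `x_o, …, x_{o+n−1} ∈ [amin, a]`,
`0 < amin`, by the pairwise tree, absent saturation,
`Var ŝ ≤ (1 + u²)^(⌈log₂ n⌉ − 1) · (3u² · (a/amin) · S² + (n−1) · quantum²/4)`, `S` the exact sum: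
above the subnormal floor the RELATIVE standard deviation is `≤ (1+u²)^((⌈log₂
n⌉−1)/2)·u·√(3a/amin)`, independent of `n`.  (Ingredients: `sqNodes ≤ a · ancMax · S` for
nonnegative leaves `≤ a`, and the pairwise tree has ancestor weight `ancMax < 3n` and height `≤
⌈log₂ n⌉`.)  PROVED (sr seat): `LowPrec.SR.valueSet_treeVar_pairwise_le_rel`
(SRTreeDesignData.lean). -/
def R3_SRPairwiseDesign (φ : Format) : Prop :=
  ∀ (x : ℕ → ℚ) (o n : ℕ), 1 ≤ n → ∀ amin a : ℚ, 0 < amin →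
    (∀ i, o ≤ i → i < o + n → amin ≤ x i ∧ x i ≤ a) →
      SR.NoSatT (valueSet φ) (SR.pairwise x o n) →
        SR.treeVar (valueSet φ) (SR.pairwise x o n)
          ≤ (1 + φ.unitRoundoff ^ 2) ^ (Nat.clog 2 n - 1)
            * (3 * φ.unitRoundoff ^ 2 * (a / amin) * (∑ i ∈ range n, x (o + i)) ^ 2
              + ((n - 1 : ℕ) : ℚ) * φ.quantum ^ 2 / 4)

/-- `R3_SRPairwiseDesign`: PROVED for every format. -/
theorem R3_SRPairwiseDesign_holds (φ : Format) : R3_SRPairwiseDesign φ :=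
  fun x o n hn _ _ hmin hx h => SR.valueSet_treeVar_pairwise_le_rel φ x o n hn hmin hx h

end Summit.Ventures.CertifiedArithmetic
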